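import Summits.Ventures.LatticeQCDFlow.Exactness.IMHCommonRandomNumbersMeetingTimeUnboundedWeights
import Summits.Ventures.LatticeQCDFlow.Exactness.IMHCommonRandomNumbersMergedForever
import HarnessLib

/-!
# The meeting time is almost surely finite WITHOUT a weight bound: from every initial coupling that integrates the weight, almost every pair
# of runs on one stream of random numbers coincides from some update on

HONEST FRAMING: exact (Metropolis-corrected) sampling algorithms for lattice gauge theory;
figures of merit are autocorrelation/cost numbers at stated couplings and volumes; no
continuum-physics claim.

Venture `LatticeQCDFlow` (cell pub-lqcd), topic `Exactness`; FANOUT row 30 (lean-1, GEN-40).  NEW WORK of the cell (standard Borel `Ω`,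
`MeasurableEq Ω`; every proposal law); sequel to GEN-38's `Exactness/IMHCommonRandomNumbersMergedForever` (`crn_chain_ae_eventually_merged`:
almost-sure merging for a normalised weight with a mode, from the geometric envelope `rⁿ`) and this generation's `…MeetingTimeUnboundedWeights`
(`P(X_n ≠ X′_n) → 0` whenever the off-diagonal start integrates `max(1, w, w′)`).  GEN-38's «runs that have met stay together»
(`crn_chain_ae_merged_stay`) is weight-free, so its argument goes through with the envelope replaced by the vanishing disagreement probability.
Setting: `K = indepMH q w`, `0 < w` measurable, NO bound on `w`; CRN pair kernel `K̂`, pair path law `P̂_{μ̂₀}`, `Δ` the diagonal.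

* **`crn_chain_notMerged_after_le_offDiagonal`** — every coupling, every `n` (weight-free): `P̂(∃ m ≥ n, X_m ≠ X′_m) ≤ P(X_n ≠ X′_n)`.
* **`crn_chain_ae_eventually_merged_unboundedWeights`** — if `∫_{Δᶜ} max(1, w(p.1), w(p.2)) dμ̂₀ < ∞` then `P̂`-almost every pair path satisfies
  `∃ n, ∀ m ≥ n, X_m = X′_m`: THE MEETING TIME IS ALMOST SURELY FINITE AND THE RUNS THEN COINCIDE FOREVER, for every weight whose starting laws
  integrate it; **`crn_chain_ae_eventually_merged_detLag_everyWeight`** — from the PRACTICAL start `K(x, ·) ⊗ δ_x` this holds FOR EVERY positive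
  normalised weight, no condition (the off-diagonal start lies below the model): the exactly unbiased coupled estimator terminates almost surely, always.
Reading (gauge files): two coupled runs of a flow-driven exact gauge sampler with an unbounded importance weight merge almost surely as soon as
both starting laws integrate the weight.
NOT CLAIMED: a rate (there is none without a weight bound); the law of the meeting time beyond its mean (`…UnboundedWeights` has the mean).
No `sorry`, no new definitions, nothing cited as a fact.
-/

noncomputable section

namespace Summit.Ventures.LatticeQCDFlow.Exactness

open MeasureTheory ProbabilityTheory Function Finset Filter Set
open scoped _root_.ENNReal unitInterval Topology
open Summit.Ventures.LatticeQCDFlow.Scoring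

variable {Ω : Type*} [MeasurableSpace Ω] {q : Measure Ω} [IsProbabilityMeasure q] {w : Ω → ℝ}

/-- **`P̂(∃ m ≥ n, X_m ≠ X′_m) ≤ P(X_n ≠ X′_n)`** for every initial coupling and every `n` — no weight hypothesis (runs that have met stay
together almost surely). [ours] -/
theorem crn_chain_notMerged_after_le_offDiagonal [MeasurableEq Ω] (hw : Measurable w) (hw0 : ∀ y, 0 < w y)
    (Khat : Kernel (Ω × Ω) (Ω × Ω)) [IsMarkovKernel Khat]
    (hK : ∀ z : Ω × Ω, Khat z = (q.prod (volume : Measure unitInterval)).map (fun p : Ω × unitInterval =>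
      ((if (p.2 : ℝ) * w z.1 ≤ w p.1 then p.1 else z.1), (if (p.2 : ℝ) * w z.2 ≤ w p.1 then p.1 else z.2))))
    (μ₀ : Measure (Ω × Ω)) [IsProbabilityMeasure μ₀] (n : ℕ) :
    (Kernel.trajMeasure (X := fun _ : ℕ => Ω × Ω) μ₀
        (fun n : ℕ => Khat.comap (fun h : (i : ↥(Finset.Iic n)) → Ω × Ω => h ⟨n, Finset.mem_Iic.2 le_rfl⟩)
          (measurable_pi_apply _))) {z | ∃ m, n ≤ m ∧ z m ∉ Set.diagonal Ω} ≤
      ((fun m : Measure (Ω × Ω) => m.bind Khat)^[n] μ₀) (Set.diagonal Ω)ᶜ := by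
  set P := Kernel.trajMeasure (X := fun _ : ℕ => Ω × Ω) μ₀
      (fun n : ℕ => Khat.comap (fun h : (i : ↥(Finset.Iic n)) → Ω × Ω => h ⟨n, Finset.mem_Iic.2 le_rfl⟩)
        (measurable_pi_apply _)) with hP
  have hsub : P {z | ∃ m, n ≤ m ∧ z m ∉ Set.diagonal Ω} ≤ P {z | z n ∉ Set.diagonal Ω} := by
    refine measure_mono_ae ?_
    filter_upwards [crn_chain_ae_merged_stay hw hw0 Khat hK μ₀] with z hz
    rintro ⟨m, hnm, hzm⟩ hzn
    exact hzm (hz n m hnm hzn)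
  refine hsub.trans (le_of_eq ?_)
  rw [hP]
  exact crn_chain_offDiagonal_eq Khat μ₀ n

/-- **THE MEETING TIME IS ALMOST SURELY FINITE WITHOUT A WEIGHT BOUND** (standard Borel `Ω`, every proposal law): if
`∫_{Δᶜ} max(1, w(p.1), w(p.2)) dμ̂₀ < ∞` then `P̂`-almost every pair path satisfies `∃ n, ∀ m ≥ n, X_m = X′_m`. [ours] -/
theorem crn_chain_ae_eventually_merged_unboundedWeights [StandardBorelSpace Ω] [Nonempty Ω] [MeasurableSingletonClass Ω] [MeasurableEq Ω]
    (hw : Measurable w) (hw0 : ∀ y, 0 < w y) (Khat : Kernel (Ω × Ω) (Ω × Ω)) [IsMarkovKernel Khat]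
    (hK : ∀ z : Ω × Ω, Khat z = (q.prod (volume : Measure unitInterval)).map (fun p : Ω × unitInterval =>
      ((if (p.2 : ℝ) * w z.1 ≤ w p.1 then p.1 else z.1), (if (p.2 : ℝ) * w z.2 ≤ w p.1 then p.1 else z.2))))
    (μ₀ : Measure (Ω × Ω)) [IsProbabilityMeasure μ₀]
    (hfin : ∫⁻ p in (Set.diagonal Ω)ᶜ, ENNReal.ofReal (max 1 (max (w p.1) (w p.2))) ∂μ₀ ≠ ∞) :
    ∀ᵐ z ∂(Kernel.trajMeasure (X := fun _ : ℕ => Ω × Ω) μ₀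
        (fun n : ℕ => Khat.comap (fun h : (i : ↥(Finset.Iic n)) → Ω × Ω => h ⟨n, Finset.mem_Iic.2 le_rfl⟩)
          (measurable_pi_apply _))),
      ∃ n, ∀ m, n ≤ m → (z m).1 = (z m).2 := by
  set P := Kernel.trajMeasure (X := fun _ : ℕ => Ω × Ω) μ₀
      (fun n : ℕ => Khat.comap (fun h : (i : ↥(Finset.Iic n)) → Ω × Ω => h ⟨n, Finset.mem_Iic.2 le_rfl⟩)
        (measurable_pi_apply _)) with hP
  -- the exceptional event «never merged for good» has probability `≤ P(X_n ≠ X′_n)` for every `n`, hence zero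
  set B : Set (ℕ → Ω × Ω) := {z | ∀ n, ∃ m, n ≤ m ∧ z m ∉ Set.diagonal Ω} with hB
  have hBle : ∀ n, P B ≤ ((fun m : Measure (Ω × Ω) => m.bind Khat)^[n] μ₀) (Set.diagonal Ω)ᶜ := fun n => by
    have h1 : P B ≤ P {z | ∃ m, n ≤ m ∧ z m ∉ Set.diagonal Ω} := measure_mono fun z (hz : z ∈ B) => hz n
    exact h1.trans (crn_chain_notMerged_after_le_offDiagonal hw hw0 Khat hK μ₀ n)
  have htend := tendsto_offDiagonal_of_lintegral_ne_top hw hw0 Khat hK μ₀ hfin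
  have hB0 : P B = 0 :=
    le_antisymm (ge_of_tendsto' htend hBle) bot_le
  rw [measure_eq_zero_iff_ae_notMem] at hB0
  filter_upwards [hB0] with z hz
  by_contra hcon
  apply hz
  intro n
  by_contra hn
  apply hcon
  refine ⟨n, fun m hnm => ?_⟩
  by_contra hm
  exact hn ⟨m, hnm, fun hd => hm (Set.mem_diagonal_iff.1 hd)⟩

/-- **FROM THE PRACTICAL START THE RUNS MERGE ALMOST SURELY FOR EVERY WEIGHT**: production run at `x`, leading run one update ahead
(`ν̂ = K(x, ·)∘(y ↦ (y, x))⁻¹`), `0 < w` measurable with `π = w·q` a probability law and nothing else: `P̂`-a.e. `∃ n, ∀ m ≥ n, X_m = X′_m`. [ours] -/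
theorem crn_chain_ae_eventually_merged_detLag_everyWeight [StandardBorelSpace Ω] [Nonempty Ω] [MeasurableSingletonClass Ω] [MeasurableEq Ω]
    (hw : Measurable w) (hw0 : ∀ y, 0 < w y) [IsProbabilityMeasure (q.withDensity fun y => ENNReal.ofReal (w y))]
    (Khat : Kernel (Ω × Ω) (Ω × Ω)) [IsMarkovKernel Khat]
    (hK : ∀ z : Ω × Ω, Khat z = (q.prod (volume : Measure unitInterval)).map (fun p : Ω × unitInterval =>
      ((if (p.2 : ℝ) * w z.1 ≤ w p.1 then p.1 else z.1), (if (p.2 : ℝ) * w z.2 ≤ w p.1 then p.1 else z.2))))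
    (x : Ω) (ν : Measure (Ω × Ω)) [IsProbabilityMeasure ν] (hν : ν = (indepMH q w x).map fun y : Ω => (y, x)) :
    ∀ᵐ z ∂(Kernel.trajMeasure (X := fun _ : ℕ => Ω × Ω) ν
        (fun n : ℕ => Khat.comap (fun h : (i : ↥(Finset.Iic n)) → Ω × Ω => h ⟨n, Finset.mem_Iic.2 le_rfl⟩)
          (measurable_pi_apply _))),
      ∃ n, ∀ m, n ≤ m → (z m).1 = (z m).2 :=
  crn_chain_ae_eventually_merged_unboundedWeights hw hw0 Khat hK ν
    (ne_top_of_le_ne_top (ENNReal.add_ne_top.2 ⟨ENNReal.ofReal_ne_top, ENNReal.one_ne_top⟩) (lintegral_offDiagonal_detLag_le hw hw0 x ν hν))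

end Summit.Ventures.LatticeQCDFlow.Exactness

end
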